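import Summits.CriticalPhenomena.CardyFormulaZ2.Theorems.CardyIKTransportIKLinearTransportStubPinnedSampler
import Mathlib.Probability.Kernel.Disintegration.StandardBorel

/-!
# Stub `stub_PinnedSampler` (line `pinned-diagram-exchange`, crux stmt-CriticalPhenomena-5076) —
# part C: the PINNED CONDITIONAL LAW (disintegration along the pinned statistic)

Registered sub-goal `ps_exists_pinnedCondLaw` (`--supports stmt-CriticalPhenomena-5076`): for every column
pattern `S` and face column `i`, the law `νmix S` of the observables admits a REGULAR CONDITIONAL LAW given the
pinned statistic `x ↦ (eraseMid i x, stripDiagram i x)`: a measurable family of probability measures `κ x` on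
`Obs`, depending on `x` only through the statistic, almost surely carried by the fibre of `x`, and
disintegrating `νmix S` along the statistic. This is the object the remaining research content of the stub
(strong spatial mixing IN MEAN of the diagram-conditioned middle data, and its covariant finitary coding) is
about; it exists because `Obs` is standard Borel (`Measure.condKernel`). Generic version
`ps_exists_condLaw` for any measurable statistic on a standard Borel space.
-/

noncomputable section

namespace Summit.CriticalPhenomena.CardyFormulaZ2.Theorems.IKLinearTransport.PinnedDiagramExchange

open scoped Classical MeasureTheory ENNReal ProbabilityTheory symmDiff
open Set MeasureTheory ProbabilityTheory Filter
open Literature.Probability.Percolation Literature.Probability.LatticeModels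

/-- REGULAR CONDITIONAL LAW GIVEN A STATISTIC (generic): on a standard Borel space, a finite measure `P`
disintegrates along any measurable `π : X → Y` (`Y` with measurable diagonal) into a measurable family of
probability measures, constant on the fibres of `π` and a.s. carried by them. [folklore] -/
theorem ps_exists_condLaw {X Y : Type*} [MeasurableSpace X] [StandardBorelSpace X] [Nonempty X]
    [MeasurableSpace Y] [MeasurableEq Y] {π : X → Y} (hπ : Measurable π) (P : Measure X)
    [IsProbabilityMeasure P] :
    ∃ κ : X → Measure X, (∀ x, IsProbabilityMeasure (κ x)) ∧ Measurable κ ∧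
      (∀ x x', π x = π x' → κ x = κ x') ∧ (∀ᵐ x ∂P, κ x {z | π z = π x} = 1) ∧
      ∀ (A : Set X), MeasurableSet A → ∀ (B : Set Y), MeasurableSet B →
        P (A ∩ π ⁻¹' B) = ∫⁻ x in π ⁻¹' B, κ x A ∂P := by
  have hpm : Measurable fun x : X => (π x, x) := hπ.prodMk measurable_id
  obtain ⟨ρ, hρ⟩ : ∃ ρ : Measure (Y × X), ρ = P.map (fun x => (π x, x)) := ⟨_, rfl⟩
  haveI : IsProbabilityMeasure ρ := hρ ▸ Measure.isProbabilityMeasure_map hpm.aemeasurable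
  have hfst : ρ.fst = P.map π := by
    rw [hρ, Measure.fst, Measure.map_map measurable_fst hpm]
    rfl
  have hdis : (P.map π) ⊗ₘ ρ.condKernel = ρ := by rw [← hfst]; exact ρ.disintegrate ρ.condKernel
  refine ⟨fun x => ρ.condKernel (π x), fun x => inferInstance, ρ.condKernel.measurable.comp hπ,
    fun x x' h => by simp only [h], ?_, fun A hA B hB => ?_⟩
  · -- a.s. carried by the fibres
    have hD : MeasurableSet {q : Y × X | π q.2 ≠ q.1} :=
      (measurableSet_eq_fun (hπ.comp measurable_snd) measurable_fst).compl
    have hzero : ∫⁻ x, ρ.condKernel (π x) {z | π z ≠ π x} ∂P = 0 := by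
      have h1 : ρ {q : Y × X | π q.2 ≠ q.1} = 0 := by
        rw [hρ, Measure.map_apply hpm hD]
        have : (fun x : X => (π x, x)) ⁻¹' {q : Y × X | π q.2 ≠ q.1} = ∅ := by ext x; simp
        rw [this, measure_empty]
      rw [← hdis, Measure.compProd_apply hD, lintegral_map
        (ρ.condKernel.measurable_kernel_prodMk_left hD) hπ] at h1
      exact h1
    have hmeas : Measurable fun x => ρ.condKernel (π x) {z | π z ≠ π x} :=
      (ρ.condKernel.measurable_kernel_prodMk_left hD).comp hπ
    have hae := (lintegral_eq_zero_iff hmeas).1 hzero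
    filter_upwards [hae] with x hx
    have hset : {z : X | π z = π x} = {z | π z ≠ π x}ᶜ := by ext z; simp
    rw [hset, prob_compl_eq_one_sub (show MeasurableSet {z : X | π z ≠ π x} from
      (measurableSet_eq_fun hπ measurable_const).compl)]
    simp only [Pi.zero_apply] at hx
    rw [hx, tsub_zero]
  · -- the disintegration identity on rectangles
    have h1 : P (A ∩ π ⁻¹' B) = ρ (B ×ˢ A) := by
      rw [hρ, Measure.map_apply hpm (hB.prod hA)]
      congr 1
      ext x
      simp only [mem_inter_iff, mem_preimage, mem_prod]
      tauto
    have h2 : ((P.map π) ⊗ₘ ρ.condKernel) (B ×ˢ A) = ρ (B ×ˢ A) := by rw [hdis]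
    rw [h1, ← h2, Measure.compProd_apply_prod hB hA,
      setLIntegral_map hB (ρ.condKernel.measurable_coe hA) hπ]

/-- THE PINNED CONDITIONAL LAW (registered sub-goal): `νmix S` disintegrates along the pinned statistic
`x ↦ (eraseMid i x, stripDiagram i x)` into a measurable family of probability laws `κ x` on `Obs`, constant
on the fibres of the statistic, a.s. carried by them, with
`νmix S (A ∩ stat⁻¹ B) = ∫⁻ x in stat⁻¹ B, κ x A ∂(νmix S)`. Applied to `S ∆ {i, i+1}` this is the
diagram-conditioned law of the middle data that a pinned sampler has to realise locally. [folklore] -/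
theorem ps_exists_pinnedCondLaw :
    ∀ (S : Set ℤ) (i : ℤ), ∃ κ : Obs → MeasureTheory.Measure Obs,
      (∀ x, MeasureTheory.IsProbabilityMeasure (κ x)) ∧ Measurable κ ∧
      (∀ x x', eraseMid i x = eraseMid i x' → stripDiagram i x = stripDiagram i x' → κ x = κ x') ∧
      (∀ᵐ x ∂(νmix S), κ x {z | eraseMid i z = eraseMid i x ∧ stripDiagram i z = stripDiagram i x} = 1) ∧
      ∀ (A : Set Obs), MeasurableSet A → ∀ (B : Set (Obs × Set (Site 2 × Site 2))), MeasurableSet B →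
        νmix S (A ∩ (fun x => (eraseMid i x, stripDiagram i x)) ⁻¹' B) =
          ∫⁻ x in (fun x => (eraseMid i x, stripDiagram i x)) ⁻¹' B, κ x A ∂(νmix S) := by
  intro S i
  haveI : StandardBorelSpace (Set (Site 2)) := inferInstanceAs (StandardBorelSpace (Site 2 → Prop))
  haveI : StandardBorelSpace (Set (Site 2 × Site 2)) :=
    inferInstanceAs (StandardBorelSpace (Site 2 × Site 2 → Prop))
  haveI := isProbabilityMeasure_nuMix S
  have hπ : Measurable fun x : Obs => (eraseMid i x, stripDiagram i x) :=
    (measurable_eraseMid i).prodMk (ps_measurable_stripDiagram i)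
  obtain ⟨κ, h1, h2, h3, h4, h5⟩ := ps_exists_condLaw hπ (νmix S)
  refine ⟨κ, h1, h2, fun x x' he hs => h3 x x' (Prod.ext he hs), ?_, h5⟩
  filter_upwards [h4] with x hx
  have : {z : Obs | eraseMid i z = eraseMid i x ∧ stripDiagram i z = stripDiagram i x} =
      {z | (eraseMid i z, stripDiagram i z) = (eraseMid i x, stripDiagram i x)} := by
    ext z; simp only [mem_setOf_eq, Prod.mk.injEq]
  rw [this]
  exact hx

end Summit.CriticalPhenomena.CardyFormulaZ2.Theorems.IKLinearTransport.PinnedDiagramExchange
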